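import Literature.AlgebraicGeometry.Resolution.RegularCentreRsopPart
import Literature.AlgebraicGeometry.Resolution.RegularQuotientIdealNested
import HarnessLib

/-!
# A regular centre inside a regular subscheme: ONE part of a regular system of parameters adapted to both

Topic: `Literature/AlgebraicGeometry/Resolution`. The `IsRsopPart` form (`RsopMonomialIdeals.lean`: part of a regular
system of parameters) of the nested Matsumura Thm. 14.2 of `RegularQuotientIdealNested.lean`, in the shape of
`RegularCentreRsopPart.exists_isRsopPart_span_range_eq` (the one-ideal case): for a regular local ring `(R, 𝔪)` and
ideals `H ⊆ C ⊆ 𝔪` with `R/H` and `R/C` regular — the local rings at a point of a regular centre `D = V(C)` lying in a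
regular closed subscheme `W = V(H)` of a regular scheme — there is ONE family `f : Fin (a + b) → R`, part of a regular
system of parameters of `R`, with `C = (f)` and `H = (f ∘ castAdd b) = (f_1, …, f_a)`. PROVED (differentials
independent ⇒ extend to a minimal basis of `𝔪`, tree `exists_extend_to_rsop`).

## Sources
* H. Matsumura, *Commutative Ring Theory*, CUP 1986, Thm. 14.2 (and the Remark after it). [Matsumura1987]
-/

noncomputable section

open IsLocalRing Module

namespace Literature.AlgebraicGeometry.Resolution

universe u

variable {R : Type u} [CommRing R] [IsRegularLocalRing R]

/-- **Nested Matsumura 14.2 in `IsRsopPart` form**: for ideals `H ⊆ C ⊆ 𝔪` of a regular local ring `R` with `R/H`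
and `R/C` regular, there is a family `f : Fin (a + b) → R` which is part of a regular system of parameters of `R`
(`IsRsopPart f`), generates `C`, and whose first `a` members `f ∘ Fin.castAdd b` generate `H`.
[cite: Matsumura1987, Thm. 14.2] -/
theorem exists_isRsopPart_nested_span_range_eq {H C : Ideal R} (hHC : H ≤ C) (hC : C ≤ maximalIdeal R)
    [IsRegularLocalRing (R ⧸ H)] [IsRegularLocalRing (R ⧸ C)] :
    ∃ (a b : ℕ) (f : Fin (a + b) → R), IsRsopPart f ∧ Ideal.span (Set.range f) = C ∧
      Ideal.span (Set.range (f ∘ Fin.castAdd b)) = H := by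
  obtain ⟨a, b, f, hm, hC', hH', hli, -, -⟩ :=
    exists_nested_isQuasiRegular_of_isRegularLocalRing_quotient hHC hC
  have hind := (linearIndependent_toCotangent_iff_forall_mem f hm).mp hli
  obtain ⟨e, y, hdim, hspan⟩ := exists_extend_to_rsop f hm hind
  exact ⟨a, b, f, ⟨inferInstance, e, y, hdim, hspan⟩, hC', hH'⟩

/-- The sub-family generating `H` is itself part of a regular system of parameters (any sub-family of a part of a
regular system of parameters is one: here `f ∘ castAdd b` followed by the remaining members `f ∘ natAdd a` and the
completing elements). [cite: Matsumura1987, Thm. 14.2] -/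
theorem exists_isRsopPart_nested_span_range_eq' {H C : Ideal R} (hHC : H ≤ C) (hC : C ≤ maximalIdeal R)
    [IsRegularLocalRing (R ⧸ H)] [IsRegularLocalRing (R ⧸ C)] :
    ∃ (a b : ℕ) (f : Fin (a + b) → R), IsRsopPart f ∧ IsRsopPart (f ∘ Fin.castAdd b) ∧
      Ideal.span (Set.range f) = C ∧ Ideal.span (Set.range (f ∘ Fin.castAdd b)) = H := by
  obtain ⟨a, b, f, hm, hC', hH', hli, -, -⟩ :=
    exists_nested_isQuasiRegular_of_isRegularLocalRing_quotient hHC hC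
  have hind := (linearIndependent_toCotangent_iff_forall_mem f hm).mp hli
  obtain ⟨e, y, hdim, hspan⟩ := exists_extend_to_rsop f hm hind
  -- the sub-family `f ∘ castAdd b`: independent differentials (sub-family of an independent family)
  have hli' : LinearIndependent (ResidueField R)
      (fun i => (maximalIdeal R).toCotangent ⟨(f ∘ Fin.castAdd b) i, hm (Fin.castAdd b i)⟩) :=
    hli.comp (Fin.castAdd b) (Fin.castAdd_injective _ _)
  have hind' := (linearIndependent_toCotangent_iff_forall_mem (f ∘ Fin.castAdd b) (fun i => hm _)).mp hli'
  obtain ⟨e', y', hdim', hspan'⟩ := exists_extend_to_rsop (f ∘ Fin.castAdd b) (fun i => hm _) hind'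
  exact ⟨a, b, f, ⟨inferInstance, e, y, hdim, hspan⟩, ⟨inferInstance, e', y', hdim', hspan'⟩, hC', hH'⟩

/-! ## In schemes: the stalks at a point of a regular centre inside a regular closed subscheme -/

section Scheme

open _root_.AlgebraicGeometry TopologicalSpace

variable {X : Scheme.{u}} [IsLocallyNoetherian X]

/-- **Nested regular pair in a scheme, at a stalk**: for ideal sheaves `H ≤ C` on a locally Noetherian scheme with
`V(H)` and `V(C)` regular (a regular centre `V(C)` inside a regular closed subscheme `V(H)`) and a point `x ∈ V(C)`
with regular local ring `𝒪_{X,x}`, there is ONE family `f : Fin (a + b) → 𝒪_{X,x}`, part of a regular system of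
parameters, with `C_x = (f)` and `H_x = (f_1, …, f_a)` (the shape of
`exists_isRsopPart_span_range_eq_stalkIdeal` for the nested pair). [cite: Matsumura1987, Thm. 14.2] -/
theorem exists_isRsopPart_nested_span_range_eq_stalkIdeal {H C : X.IdealSheafData} (hHC : H ≤ C)
    (hH : Scheme.IsRegular H.subscheme) (hC : Scheme.IsRegular C.subscheme) {x : X}
    [IsRegularLocalRing (X.presheaf.stalk x)] (hx : x ∈ C.support) :
    ∃ (a b : ℕ) (f : Fin (a + b) → X.presheaf.stalk x), IsRsopPart f ∧
      Ideal.span (Set.range f) = stalkIdeal C x ∧ Ideal.span (Set.range (f ∘ Fin.castAdd b)) = stalkIdeal H x := by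
  have hxH : x ∈ H.support := Scheme.IdealSheafData.support_antitone hHC hx
  haveI := isRegularLocalRing_stalk_quotient_stalkIdeal hC hx
  haveI := isRegularLocalRing_stalk_quotient_stalkIdeal hH hxH
  exact exists_isRsopPart_nested_span_range_eq (stalkIdeal_mono hHC x)
    ((mem_support_iff_stalkIdeal_le C x).mp hx)

/-- The same for reduced closed subsets `D ⊆ W` (`vanishingIdeal`), `V(𝓘_W)` and `V(𝓘_D)` regular, at `x ∈ D`.
[cite: Matsumura1987, Thm. 14.2] -/
theorem exists_isRsopPart_nested_span_range_eq_stalkIdeal_of_mem_closeds {W D : TopologicalSpace.Closeds X}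
    (hDW : D ≤ W) (hW : Scheme.IsRegular (Scheme.IdealSheafData.vanishingIdeal W).subscheme)
    (hD : Scheme.IsRegular (Scheme.IdealSheafData.vanishingIdeal D).subscheme) {x : X}
    [IsRegularLocalRing (X.presheaf.stalk x)] (hx : x ∈ (D : Set X)) :
    ∃ (a b : ℕ) (f : Fin (a + b) → X.presheaf.stalk x), IsRsopPart f ∧
      Ideal.span (Set.range f) = stalkIdeal (Scheme.IdealSheafData.vanishingIdeal D) x ∧
      Ideal.span (Set.range (f ∘ Fin.castAdd b)) = stalkIdeal (Scheme.IdealSheafData.vanishingIdeal W) x := by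
  refine exists_isRsopPart_nested_span_range_eq_stalkIdeal
    (Scheme.IdealSheafData.vanishingIdeal_antimono hDW) hW hD ?_
  rw [← SetLike.mem_coe, Scheme.IdealSheafData.coe_support_vanishingIdeal]
  exact hx

end Scheme

end Literature.AlgebraicGeometry.Resolution

end
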